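import Mathlib
import Summits.NavierStokesRegularity.NavierStokesRegularity.Theorems.FilamentSkeletonRssSkeletonJ1NormalBlockWindow
import Summits.NavierStokesRegularity.NavierStokesRegularity.Theorems.FilamentSkeletonRssSkeletonJ1NormalBlockCeiling

/-!
# `SkeletonJ1` (stmt-NavierStokesRegularity-27413, Variant A1α) · registered stub `stub_normalBlock : NormalBlock` of the birth skeleton
# (12616aef6aab368d) — PROVED MODULO ONE SLIP-REGULARITY HYPOTHESIS

`normalBlock_of_slipRegular`: the registered text of `NormalBlock` VERBATIM (box constants, threshold `∃ Γ₁`, the A1α clause block with the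
area law, the skeleton's own frames, clause 13-J; conclusion = clause 12 for every `j`: normal block of `A_j = Dv(X_j(c_j))` with trace `< 0`
and determinant `> 0`) with exactly ONE hypothesis added after the clause block, on the slip `w` alone:
  `(∀ j τ, |w_j′(τ)| ≤ Λ) ∧ (∀ j s, |s − c_j| ≤ √(4κ/δ) → 3/2 + δ ≤ w_j′(s))`, `κ = e^{−(1+γ_E−log 2)}`
— the near-straight regime's slip-slope bound, and the waist supercriticality `w′ ≥ 3/2 + δ` UNIFORMLY on the `O(1)` core window around each
zero (the registered text has it AT `c_j` only).  Assembly of the three landed pieces: the core-window form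
`SkeletonJ1NormalBlockWindow.normalBlock_of_coreWindow` (p814423; matched-kernel clause 12, lane 19175-p1's `matched_clause12_of_skeleton_core`),
the FLOOR `4/Λ ≤ Aa` from `|w′| ≤ Λ` + area law (`areaLaw_floor_of_deriv_bound`, p814776) and the Summit.NavierStokesRegularity.NavierStokesRegularity.Theorems.SkeletonJ1NormalBlockCeiling `Aa ≤ 4/δ` on the window from the
uniform supercriticality + area law (`SkeletonJ1NormalBlockCeiling.areaLaw_ceiling_window`, p815248), with `m₁ = 4κ/max Λ 1`, `m₂ = 4κ/δ`.
REMAINING GAP TO THE REGISTERED LETTER (census): the uniform supercriticality on the window is not among the A1α clauses (they give `w′(c_j) ≥ 3/2+δ`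
at the zero and no modulus for `w′`); for an exactly tangent skeleton `w′ = ⟪Dv·X′, X′⟫` varies on the partner scale `ρ√Γ ≫ √(4κ/δ)` (design
note 28296-g22 §6(a)), so the hypothesis is the expected regime — but deriving it from the clauses is a Biot–Savart strain-modulus lemma (size M)
nobody has typed.
HONEST FRAMING: bookkeeping about a HYPOTHETICAL filament skeleton on the NEGATIVE side of a MODEL route (A1α aside); `SkeletonJ1` stays OPEN;
nothing here bears on Navier–Stokes regularity or blow-up.  `--supports stmt-NavierStokesRegularity-27413`.
-/

set_option linter.dupNamespace false

noncomputable section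

namespace Summit.NavierStokesRegularity.NavierStokesRegularity.Theorems.SkeletonJ1NormalBlockSlipRegular

open Set Function Filter MeasureTheory Real
open Literature.Analysis.FluidPDE
open scoped InnerProductSpace Topology

/-- **Registered stub `stub_normalBlock` of `SkeletonJ1` (27413) modulo ONE slip-regularity hypothesis** (`|w′| ≤ Λ` and
`w′ ≥ 3/2 + δ` on `|s − c_j| ≤ √(4κ/δ)`): clause 12 for every `j`, `Γ ≥ Γ₁(consts)`.  See the module docstring. [folklore] -/
theorem normalBlock_of_slipRegular :
    ∀ (N:ℕ) (δ ρ K Λ a b cnd η Rw Rb cg θ₀:ℝ), 0 < N → 0 < δ → 0 < ρ → 0 ≤ a → 0 < η → 0 < Rw → 0 < Rb → 0 < cg → 0 < θ₀ → 2*K*ρ≤1 → ∃ Γ₁:ℝ, ∀ Γ:ℝ, Γ₁≤Γ → ∀ (γ:Fin N → ℝ) (α:ℝ) (X:Fin N → ℝ → EuclideanSpace ℝ (Fin 3)) (w:Fin N → ℝ → ℝ) (c:Fin N → ℝ) (m n:Fin N → EuclideanSpace ℝ (Fin 3)) (Aa:Fin N → ℝ → ℝ) (u:(Fin N → ℝ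 → EuclideanSpace ℝ (Fin 3)) → EuclideanSpace ℝ (Fin 3) → EuclideanSpace ℝ (Fin 3)) (v:EuclideanSpace ℝ (Fin 3) → EuclideanSpace ℝ (Fin 3)) (A:Fin N → (EuclideanSpace ℝ (Fin 3) →L[ℝ] EuclideanSpace ℝ (Fin 3))) (T:(Fin N → ℝ → EuclideanSpace ℝ (Fin 3)) → Fin N → ℝ → EuclideanSpace ℝ (Fin 3)), (∀ Z y, u Z y = ∑ k, (Γ*γ k/(4*Real.pi))•∫ σ:ℝ, ((‖y-Z k σ‖^2+Real.exp (-(1+Real.eulerMascheroniConstant-Real.log 2))*Aa k σ)^(3/2:ℝ))⁻¹•cross (deriv (Z k) σ) (y-Z k σ))→(∀ y, v y = u X y+(1/2:ℝ)•y-α•cross (EuclideanSpace.single 2 1) y)→(∀ j, A j = fderiv ℝ v (X j (c j)))→(∀ Z j τ, T Z j τ = (u Z (Z j τ)+(1/2:ℝ)•Z j τ-α•cross (EuclideanSpace.single 2 1) (Z j τ))-(⟪u Z (Z j τ)+(1/2:ℝ)•Z j τ-α•cross (EuclideanSpace.single 2 1) (Z j τ), deriv (Z j) τ⟫_ℝ/‖deriv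 (Z j) τ‖^2)•deriv (Z j) τ)→((α ≠ 0 ∧ (∀ j, γ j ≠ 0)∧(∀ j, ContDiff ℝ 2 (X j) ∧ Differentiable ℝ (w j)∧(∀ τ, ‖deriv (X j) τ‖ = 1)∧(∀ τ, ‖iteratedDeriv 2 (X j) τ‖*√Γ≤K) ∧ Tendsto (fun τ => ‖X j τ‖) (cocompact ℝ) atTop)∧(∀ j k, j ≠ k → ∀ τ σ, ρ*√Γ≤‖X j τ-X k σ‖)∧(∀ j τ σ, ρ*√Γ≤|τ-σ| → cg*ρ*√Γ≤‖X j τ-X j σ‖)∧(∀ j τ, cg*|τ-c j|≤Rw*√Γ+‖X j τ‖)∧(∀ j τ, w j τ = ⟪v (X j τ), deriv (X j) τ⟫_ℝ)∧(∀ j τ, ‖X j τ‖≤Rb*√(Γ*Real.log Γ) → v (X j τ) = w j τ•deriv (X j) τ)∧(∀ j, ‖X j (c j)‖≤Rw*√Γ)∧(∀ j, |⟪deriv (X j) (c j), EuclideanSpace.single 2 1⟫_ℝ|≤1-θ₀)∧(θ₀≤|α| ∧ |α|≤θ₀⁻¹ ∧ ∀ j, θ₀≤|γ j| ∧ |γ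 j|≤θ₀⁻¹)∧(∀ j, w j (c j) = 0 ∧ (∀ τ, w j τ = 0 → τ = c j) ∧ 3/2+δ≤deriv (w j) (c j) ∧ deriv (w j) (c j)≤Λ)∧(∀ j, Differentiable ℝ (Aa j) ∧ (∀ τ, 0 < Aa j τ) ∧ ∀ τ, w j τ*deriv (Aa j) τ = (3/2-deriv (w j) τ)*Aa j τ+4)∧(∀ j, Orthonormal ℝ ![deriv (X j) (c j), m j, n j])∧(∀ Y:Fin N → ℝ → EuclideanSpace ℝ (Fin 3), (∀ j, ContDiff ℝ 2 (Y j))→(∀ j τ, ⟪Y j τ, deriv (X j) τ⟫_ℝ = 0) → (∀ j τ, Rb*√(Γ*Real.log Γ) < ‖X j τ‖ → Y j τ = 0) → ∑ j, ⟪Y j (c j), cross (EuclideanSpace.single 2 1) (X j (c j))⟫_ℝ = 0 → (∀ j τ, ‖Y j τ‖+‖deriv (Y j) τ‖+‖iteratedDeriv 2 (Y j) τ‖≤(1+|τ-c j|)^b) → ∀ L:ℝ, (∀ j τ, ‖deriv (fun s:ℝ => T (fun k σ => X k σ+s•Y k σ) j τ) 0‖≤L*(1+|τ-c j|)^a) →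 ∀ j τ, ‖Y j τ‖≤cnd*L*(1+|τ-c j|)^b))) → ((∀ j τ, |deriv (w j) τ| ≤ Λ) ∧ (∀ j s, |s - c j| ≤ √(4 * Real.exp (-(1+Real.eulerMascheroniConstant-Real.log 2)) / δ) → 3/2 + δ ≤ deriv (w j) s)) → ∀ j, ⟪A j (m j), m j⟫_ℝ+⟪A j (n j), n j⟫_ℝ < 0 ∧ ⟪A j (n j), m j⟫_ℝ * ⟪A j (m j), n j⟫_ℝ < ⟪A j (m j), m j⟫_ℝ * ⟪A j (n j), n j⟫_ℝ := by
  intro N δ ρ K Λ a b cnd η Rw Rb cg θ₀ hN hδ hρ ha hη hRw hRb hcg hθ₀ hKρ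
  have hκ0 : 0 < Real.exp (-(1 + Real.eulerMascheroniConstant - Real.log 2)) := Real.exp_pos _
  set κ : ℝ := Real.exp (-(1 + Real.eulerMascheroniConstant - Real.log 2)) with hκ
  have hmax : 0 < max Λ 1 := lt_of_lt_of_le one_pos (le_max_right _ _)
  have hm₁ : 0 < 4 * κ / max Λ 1 := by positivity
  have hm₂ : 0 < 4 * κ / δ := by positivity
  obtain ⟨Γ₁, hΓ₁⟩ := Summit.NavierStokesRegularity.NavierStokesRegularity.Theorems.SkeletonJ1NormalBlockWindow.normalBlock_of_coreWindow N δ ρ K Λ a b cnd η Rw Rb cg θ₀ (4 * κ / max Λ 1) (4 * κ / δ)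
    hN hδ hρ ha hη hRw hRb hcg hθ₀ hm₁ hm₂ hKρ
  refine ⟨Γ₁, ?_⟩
  intro Γ hΓ γ α X w c m n Aa u v A T hu hv hA hT hsk hreg' j
  obtain ⟨hwΛ, hsup⟩ := hreg'
  have hsk' := hsk
  obtain ⟨-, -, hreg, -, -, -, -, -, -, -, -, hstag, harea, -, -⟩ := hsk'
  -- `Λ ≥ 3/2 + δ > 1`
  have hΛ : 0 < Λ := by
    have h1 := (hstag j).2.2.1
    have h2 := (hstag j).2.2.2
    linarith
  -- the core window from the slip regularity
  have hfloor : ∀ k σ, 4 * κ / max Λ 1 ≤ κ * Aa k σ := by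
    intro k σ
    have hf := Summit.NavierStokesRegularity.NavierStokesRegularity.Theorems.SkeletonJ1NormalBlockWindow.areaLaw_floor_of_deriv_bound (hreg k).2.1 (harea k).1 (harea k).2.2 (harea k).2.1 (hstag k).1 (hwΛ k) σ
    calc 4 * κ / max Λ 1 ≤ 4 * κ / Λ := div_le_div_of_nonneg_left (by positivity) hΛ (le_max_left _ _)
      _ = κ * (4 / Λ) := by ring
      _ ≤ κ * Aa k σ := mul_le_mul_of_nonneg_left hf hκ0.le
  have hceil : ∀ i σ, |σ - c i| ≤ √(4 * κ / δ) → κ * Aa i σ ≤ 4 * κ / δ := by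
    intro i σ hσ
    have hc := Summit.NavierStokesRegularity.NavierStokesRegularity.Theorems.SkeletonJ1NormalBlockCeiling.areaLaw_ceiling_window (hreg i).2.1 (harea i).1 (harea i).2.2 (harea i).2.1 (hstag i).1 hδ
      (hsup i) hσ
    calc κ * Aa i σ ≤ κ * (4 / δ) := mul_le_mul_of_nonneg_left hc hκ0.le
      _ = 4 * κ / δ := by ring
  exact hΓ₁ Γ hΓ γ α X w c m n Aa u v A T hu hv hA hT hsk ⟨hfloor, hceil⟩ j

end Summit.NavierStokesRegularity.NavierStokesRegularity.Theorems.SkeletonJ1NormalBlockSlipRegular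

end
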